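import Summits.KontsevichZagierPeriods.KontsevichZagierPeriods.Theorems.RealEllipticSectorKernel.Negative.SecondKindCM66
import Literature.NumberTheory.Transcendental.OnePeriodsMasserCMProofs
import Literature.NumberTheory.EllipticCurves.GaussianLatticeQuarterValues
import Literature.NumberTheory.EllipticCurves.LatticeJInvariant
import Literature.NumberTheory.Transcendental.GammaMonomialsProofs
import Mathlib.Analysis.SpecialFunctions.Gamma.Beta
import Mathlib.MeasureTheory.Integral.IntegralEqImproper

/-!
# `RealEllipticSectorKernel` (stmt-KontsevichZagierPeriods-10632) — negative knowledge, F12: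
# the complete period-relation module at the rational CM curve `y² = 4x³ − 44x + 56` (`j = 66³`)

Support file (cdisprove seat, cycle 3; work file `Cruxes/RealEllipticSectorKernel/Disproof.lean`,
§11). Cycle 2 proved, by the rational 2-isogeny onto `Y² = u³ − 16u`, that at `(q₂,q₃) = (44,−56)`
the four numbers of the crux's inlined hypothesis lie in `ℚΛ + ℚM₄`
(`Λ = lemHalf = Γ(1/4)²/(4√(2π))`, `M₄ = ∫₀¹ w dw/√(4w − 4w³)`): `J₀ = Λ`, `K₀ = Λ/2`,
`J₁ = Λ − 2M₄`, `K₁ = Λ/2 + M₄` — whence the two INTEGER relations `J₀ = 2K₀`,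
`2J₀ − J₁ − 2K₁ = 0` (`CMPoint`, `CMPointSecondKind`). This file closes the analysis:

* Part A — **`Λ·M₄ = π/4`** (`lemHalf_mul_M₄`), i.e. Legendre's relation at the lemniscatic point,
  proved with no Weierstrass theory: `4M₄ = B(3/4, 1/2)` by the substitution `x = w²`
  (`integral_comp_rpow_Ioi`) and `B(3/4,1/2) = Γ(3/4)Γ(1/2)/Γ(5/4) = 4π√(2π)/Γ(1/4)²`
  (reflection formula). Closed forms: `J₁ = Λ − π/(2Λ)`, `K₁ = Λ/2 + π/(4Λ)`,
  `J₀K₁ − J₁K₀ = π/2` (`legendre_cm`).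
* Part B — **`1, Λ, M₄` are linearly independent over the real algebraic numbers**
  (`qbarIndep_one_lemHalf_M₄`): Masser's Theorem III, which is a THEOREM of the tree
  (`masser_ellipticPeriods_cm_holds`, from Chudnovsky; axioms standard), applied to the
  `PeriodPair` `ϖ₀(ℤi + ℤ)` (`gaussFour`: `g₂ = 4`, `g₃ = 0`, CM by `i`, `ω₁ = ϖ₀ i`,
  `η₁ = −πi/ϖ₀` from the tree's Gaussian-lattice values), `ϖ₀ = 2Λ`.
* Part C — in the companion file `Negative/RelationModuleCM66.lean` (namespace
  `…CMPointTranscendence`):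
  `relation_cm_iff` — **the complete list of `ℚ̄`-linear relations among `1, J₀, J₁, K₀, K₁` at
  `(44,−56)` is the 2-dimensional space `{a = 0, e = 2c, 2b + 4c + d = 0}`** (the crux's hypothesis
  fails there in exactly two independent ways); `intRelation_cm_iff` — the integer relation lattice
  is `ℤ(1,0,−2,0) ⊕ ℤ(2,−1,0,−2)`, the coefficient vectors of `cmElem`, `cmElem₂`;
  `rigid_one_J₀_J₁_cm` / `ellipticMomentKernel_rigid_cm` — **the sibling crux
  `EllipticMomentKernel`'s inlined hypothesis `Rigid 44 (−56)` HOLDS**, unconditionally in Lean, so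
  that crux is non-vacuous at a rational CM curve (`kernelClaim_cm_of_ellipticMomentKernel`);
  `kernel_cm_iff_transfers` / `kernel_cm_iff_cmElems` — **exact remaining content**: given the
  integer normal form that the route's reduction produces, `Kernel 44 (−56)` ⇔
  `cmElem ∈ relations ∧ cmElem₂ ∈ relations` (two CM isogeny transfers, first and second kind;
  integer division is a derived rule, `MzvKernelInKZ.Negative.mem_relations_of_nsmul_mem`).

References: Masser 1975 (LNM 437) Ch. III Thm. III and Lemma 3.1; Chudnovsky 1984 Ch. 7 Thm 2.6;
Whittaker–Watson §12.41 (Beta function), §22.8; Lawden 1989 §6.13 (Legendre).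
-/

noncomputable section

namespace Summit.KontsevichZagierPeriods.RealEllipticSectorKernel.CM66

open MeasureTheory Set Real

/-- **Euler's Beta integral at `(3/4, 1/2)`**: `∫₀¹ x^{-1/4}(1 − x)^{-1/2} dx = Γ(3/4)Γ(1/2)/Γ(5/4)`
(real form of Mathlib's `Complex.betaIntegral_eq_Gamma_mul_div`). [folklore] -/
theorem integral_rpow_neg_quarter_mul_rpow_neg_half :
    ∫ x in (0 : ℝ)..1, x ^ (-(1 / 4 : ℝ)) * (1 - x) ^ (-(1 / 2 : ℝ)) =
      Real.Gamma (3 / 4) * Real.Gamma (1 / 2) / Real.Gamma (5 / 4) := by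
  have hB := Complex.betaIntegral_eq_Gamma_mul_div (3 / 4 : ℂ) (1 / 2 : ℂ) (by norm_num)
    (by norm_num)
  have hlhs : Complex.betaIntegral (3 / 4 : ℂ) (1 / 2 : ℂ) =
      ((∫ x in (0 : ℝ)..1, x ^ (-(1 / 4 : ℝ)) * (1 - x) ^ (-(1 / 2 : ℝ)) : ℝ) : ℂ) := by
    unfold Complex.betaIntegral
    rw [← intervalIntegral.integral_ofReal]
    refine intervalIntegral.integral_congr (fun x hx => ?_)
    rw [uIcc_of_le zero_le_one] at hx
    have h1 : (x : ℂ) ^ ((3 / 4 : ℂ) - 1) = ((x ^ (-(1 / 4 : ℝ)) : ℝ) : ℂ) := by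
      rw [Complex.ofReal_cpow hx.1]; push_cast; ring_nf
    have h2 : (1 - (x : ℂ)) ^ ((1 / 2 : ℂ) - 1) = (((1 - x) ^ (-(1 / 2 : ℝ)) : ℝ) : ℂ) := by
      rw [Complex.ofReal_cpow (by linarith [hx.2])]; push_cast; ring_nf
    simp only [h1, h2]
    push_cast
    ring
  rw [hlhs] at hB
  have hrhs : Complex.Gamma (3 / 4 : ℂ) * Complex.Gamma (1 / 2 : ℂ) /
      Complex.Gamma ((3 / 4 : ℂ) + 1 / 2) =
      ((Real.Gamma (3 / 4) * Real.Gamma (1 / 2) / Real.Gamma (5 / 4) : ℝ) : ℂ) := by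
    rw [show (3 / 4 : ℂ) + 1 / 2 = ((5 / 4 : ℝ) : ℂ) by push_cast; ring,
      show (3 / 4 : ℂ) = ((3 / 4 : ℝ) : ℂ) by push_cast; ring,
      show (1 / 2 : ℂ) = ((1 / 2 : ℝ) : ℂ) by push_cast; ring,
      Complex.Gamma_ofReal, Complex.Gamma_ofReal, Complex.Gamma_ofReal]
    push_cast
    ring
  rw [hrhs] at hB
  exact_mod_cast hB

/-- `Γ(3/4)Γ(1/2)/Γ(5/4) = 4π√(2π)/Γ(1/4)²` (`Γ(5/4) = Γ(1/4)/4`, reflection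
`Γ(1/4)Γ(3/4) = π√2`, `Γ(1/2) = √π`). [folklore] -/
theorem Gamma_three_quarters_mul_Gamma_half_div_Gamma_five_quarters :
    Real.Gamma (3 / 4) * Real.Gamma (1 / 2) / Real.Gamma (5 / 4) =
      4 * π * Real.sqrt (2 * π) / Real.Gamma (1 / 4) ^ 2 := by
  have hrefl := Real.Gamma_mul_Gamma_one_sub (1 / 4 : ℝ)
  rw [show (1 : ℝ) - 1 / 4 = 3 / 4 by norm_num, show π * (1 / 4 : ℝ) = π / 4 by ring,
    Real.sin_pi_div_four] at hrefl
  have h54 : Real.Gamma (5 / 4) = 1 / 4 * Real.Gamma (1 / 4) := by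
    rw [show (5 / 4 : ℝ) = 1 / 4 + 1 by norm_num, Real.Gamma_add_one (by norm_num)]
  have h14 : Real.Gamma (1 / 4) ≠ 0 := (Real.Gamma_pos_of_pos (by norm_num)).ne'
  have hs2 : Real.sqrt 2 ≠ 0 := by positivity
  have hsπ : Real.sqrt π ≠ 0 := by positivity
  have h34eq : Real.Gamma (3 / 4) = π / (Real.sqrt 2 / 2) / Real.Gamma (1 / 4) := by
    rw [← hrefl]; field_simp
  rw [h54, h34eq, Real.Gamma_one_half_eq, Real.sqrt_mul' _ Real.pi_pos.le]
  have h22 : Real.sqrt 2 ^ 2 = 2 := Real.sq_sqrt (by norm_num : (0:ℝ) ≤ 2)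
  field_simp
  linear_combination -h22


/-- Pointwise identity behind the substitution `x = w²` in `M₄`: for `0 < w < 1`,
`2w · (w²)^{-1/4} (1 − w²)^{-1/2} = 4 · w/√(4w − 4w³)`. [folklore] -/
theorem M₄_subst_identity {w : ℝ} (hw0 : 0 < w) (hw1 : w < 1) :
    2 * w ^ ((2:ℝ) - 1) * ((w ^ (2:ℝ)) ^ (-(1 / 4 : ℝ)) * (1 - w ^ (2:ℝ)) ^ (-(1 / 2 : ℝ))) =
      4 * (w * hI w) := by
  have hb : 0 < 1 - w ^ 2 := by nlinarith
  have e0 : w ^ ((2:ℝ) - 1) = w := by norm_num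
  have e1 : (w ^ (2:ℝ)) ^ (-(1 / 4 : ℝ)) = w ^ (-(1 / 2 : ℝ)) := by
    rw [← Real.rpow_mul hw0.le]; norm_num
  have e2 : (1 - w ^ (2:ℝ)) = 1 - w ^ 2 := by rw [Real.rpow_two]
  have e3 : hI w = (2 * (w ^ (1 / 2 : ℝ) * (1 - w ^ 2) ^ (1 / 2 : ℝ)))⁻¹ := by
    unfold hI
    rw [show 4 * w - 4 * w ^ 3 = 4 * (w * (1 - w ^ 2)) by ring,
      Real.sqrt_mul (by norm_num : (0:ℝ) ≤ 4), show (4:ℝ) = 2 ^ 2 by norm_num,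
      Real.sqrt_sq (by norm_num : (0:ℝ) ≤ 2), Real.sqrt_eq_rpow, Real.mul_rpow hw0.le hb.le]
  rw [e0, e1, e2, e3, Real.rpow_neg hw0.le, Real.rpow_neg hb.le]
  have h1 : 0 < w ^ (1 / 2 : ℝ) := Real.rpow_pos_of_pos hw0 _
  have h2 : 0 < (1 - w ^ 2) ^ (1 / 2 : ℝ) := Real.rpow_pos_of_pos hb _
  field_simp
  ring

/-- **`4M₄ = B(3/4, 1/2)`** by the substitution `x = w²` (Mathlib `integral_comp_rpow_Ioi`, `p = 2`).
[folklore] -/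
theorem four_mul_M₄_eq_beta :
    4 * M₄ = Real.Gamma (3 / 4) * Real.Gamma (1 / 2) / Real.Gamma (5 / 4) := by
  set h : ℝ → ℝ := fun y => y ^ (-(1 / 4 : ℝ)) * (1 - y) ^ (-(1 / 2 : ℝ)) with hh
  have key := integral_comp_rpow_Ioi (indicator (Ioo 0 1) h) (p := 2) (by norm_num)
  rw [setIntegral_indicator measurableSet_Ioo,
    show Ioi (0 : ℝ) ∩ Ioo 0 1 = Ioo 0 1 from inter_eq_right.mpr Ioo_subset_Ioi_self,
    ← integral_Ioc_eq_integral_Ioo, ← intervalIntegral.integral_of_le zero_le_one] at key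
  have hbeta : ∫ y in (0 : ℝ)..1, h y =
      Real.Gamma (3 / 4) * Real.Gamma (1 / 2) / Real.Gamma (5 / 4) := by
    simp only [hh]
    rw [integral_rpow_neg_quarter_mul_rpow_neg_half]
  rw [hbeta] at key
  have hL : EqOn (fun x : ℝ => (|(2 : ℝ)| * x ^ ((2 : ℝ) - 1)) • indicator (Ioo 0 1) h (x ^ (2 : ℝ)))
      (indicator (Ioo 0 1) fun w => 4 * (w * hI w)) (Ioi 0) := by
    intro w hw
    have hw0 : 0 < w := hw
    simp only
    by_cases h1 : w < 1
    · have hmem : w ^ (2 : ℝ) ∈ Ioo (0 : ℝ) 1 := by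
        rw [Real.rpow_two]
        exact ⟨by positivity, by nlinarith⟩
      rw [indicator_of_mem hmem, indicator_of_mem (show w ∈ Ioo (0 : ℝ) 1 from ⟨hw0, h1⟩),
        smul_eq_mul, show |(2 : ℝ)| = 2 by norm_num, hh]
      exact M₄_subst_identity hw0 h1
    · have hnot : w ^ (2 : ℝ) ∉ Ioo (0 : ℝ) 1 := by
        rintro ⟨-, hlt⟩
        rw [Real.rpow_two] at hlt
        have hw1 : 1 ≤ w := not_lt.mp h1
        nlinarith
      rw [indicator_of_notMem hnot,
        indicator_of_notMem (show w ∉ Ioo (0 : ℝ) 1 from fun h' => h1 h'.2), smul_zero]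
  rw [setIntegral_congr_fun measurableSet_Ioi hL, setIntegral_indicator measurableSet_Ioo,
    show Ioi (0 : ℝ) ∩ Ioo 0 1 = Ioo 0 1 from inter_eq_right.mpr Ioo_subset_Ioi_self,
    integral_const_mul] at key
  exact key

/-- **`M₄ = π√(2π)/Γ(1/4)²`** (`= ¼B(3/4,1/2) = 0.59907…`). [folklore] -/
theorem M₄_eq : M₄ = π * Real.sqrt (2 * π) / Real.Gamma (1 / 4) ^ 2 := by
  have h := four_mul_M₄_eq_beta
  rw [Gamma_three_quarters_mul_Gamma_half_div_Gamma_five_quarters] at h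
  have h14 : Real.Gamma (1 / 4) ≠ 0 := (Real.Gamma_pos_of_pos (by norm_num)).ne'
  field_simp at h ⊢
  linarith

/-- **Legendre's relation at the lemniscatic point, as a Beta-function identity**:
`lemHalf · M₄ = π/4`, i.e. `J₀(44,−56)·M₄ = π/4` (`lemHalf = Γ(1/4)²/(4√(2π))`). [folklore] -/
theorem lemHalf_mul_M₄ : lemHalf * M₄ = π / 4 := by
  rw [M₄_eq, lemHalf]
  have h14 : Real.Gamma (1 / 4) ≠ 0 := (Real.Gamma_pos_of_pos (by norm_num)).ne'
  have hs : Real.sqrt (2 * π) ≠ 0 := by positivity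
  field_simp

/-- `M₄ = π/(4·lemHalf)`. [folklore] -/
theorem M₄_eq_pi_div : M₄ = π / (4 * lemHalf) := by
  have h := lemHalf_mul_M₄
  have hl := lemHalf_pos
  field_simp
  linarith


/-! ### Part B: the scaled Gaussian lattice `ϖ₀(ℤi + ℤ)` (`g₂ = 4`, `g₃ = 0`, CM by `i`) and
Masser's Theorem III (PROVED in the tree from Chudnovsky): `1, π, ϖ₀, π/ϖ₀` are `ℚ̄`-independent -/

open Complex in
/-- The lemniscatic constant `ϖ₀ = Γ(1/4)²/(2√(2π)) = 2·lemHalf` (real period of `y² = x³ − x`).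
[folklore] -/
def varpi : ℝ := Real.Gamma (1 / 4) ^ 2 / (2 * Real.sqrt (2 * π))

/-- `ϖ₀ = 2·lemHalf`. [folklore] -/
theorem varpi_eq : varpi = 2 * lemHalf := by
  unfold varpi lemHalf
  have hs : Real.sqrt (2 * π) ≠ 0 := by positivity
  field_simp
  ring

/-- `0 < ϖ₀`. [folklore] -/
theorem varpi_pos : 0 < varpi := by rw [varpi_eq]; exact mul_pos two_pos lemHalf_pos

/-- `(ϖ₀ : ℂ) ≠ 0`. [folklore] -/
theorem varpi_ne : ((varpi : ℝ) : ℂ) ≠ 0 := Complex.ofReal_ne_zero.mpr varpi_pos.ne'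

/-- The period lattice `ϖ₀(ℤi + ℤ)` of `y² = 4x³ − 4x` as a Mathlib `PeriodPair`
(`ω₁ = ϖ₀ i`, `ω₂ = ϖ₀`). [folklore] -/
def gaussFour : PeriodPair :=
  (PeriodPair.ofUpperHalfPlane UpperHalfPlane.I).mulLeft ((varpi : ℝ) : ℂ) varpi_ne

/-- `g₂(ϖ₀(ℤi+ℤ)) = 4` (from the tree's `g₂(ℤi + ℤ) = 4ϖ₀⁴`). [folklore] -/
theorem g₂_gaussFour : gaussFour.g₂ = 4 := by
  have h : ((varpi : ℝ) : ℂ) ≠ 0 := varpi_ne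
  have e : (PeriodPair.ofUpperHalfPlane UpperHalfPlane.I).g₂ = 4 * ((varpi : ℝ) : ℂ) ^ 4 :=
    Literature.NumberTheory.EllipticCurves.GaussianLattice.g₂_eq_varpi'
  rw [gaussFour, PeriodPair.g₂_mulLeft, e]
  field_simp

/-- `g₃(ϖ₀(ℤi+ℤ)) = 0`. [folklore] -/
theorem g₃_gaussFour : gaussFour.g₃ = 0 := by
  rw [gaussFour, PeriodPair.g₃_mulLeft, PeriodPair.g₃_ofUpperHalfPlane_I, mul_zero]

/-- The lattice `ϖ₀(ℤi + ℤ)` has complex multiplication (by `i`). [folklore] -/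
theorem hasCM_gaussFour : gaussFour.HasCM := by
  refine ⟨Complex.I, fun n h => ?_, fun l hl => ?_⟩
  · have := congrArg Complex.im h
    simp at this
  · rw [gaussFour, PeriodPair.mem_mulLeft_lattice] at hl ⊢
    rw [show ((varpi : ℝ) : ℂ)⁻¹ * (Complex.I * l) = Complex.I * (((varpi : ℝ) : ℂ)⁻¹ * l) by ring]
    exact (PeriodPair.I_mul_mem_lattice_ofUpperHalfPlane_I_iff _).mpr hl

/-- `ω₁ = ϖ₀ i`. [folklore] -/
theorem ω₁_gaussFour : gaussFour.ω₁ = ((varpi : ℝ) : ℂ) * Complex.I := by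
  simp [gaussFour]

/-- `η₁ = −πi/ϖ₀` (tree: `η₁(ℤi + ℤ) = −πi`, homogeneity of degree `−1`). [folklore] -/
theorem η₁_gaussFour : gaussFour.η₁ = ((varpi : ℝ) : ℂ)⁻¹ * (-(π * Complex.I)) := by
  rw [gaussFour, PeriodPair.η₁_mulLeft _ varpi_ne,
    Literature.NumberTheory.EllipticCurves.GaussianLattice.η₁_eq]

/-- **Masser's Theorem III at the lemniscatic lattice** (tree theorem
`masser_ellipticPeriods_cm_holds`, proved from Chudnovsky): `1, 2πi, ϖ₀i, −πi/ϖ₀` are linearly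
independent over `ℚ̄`. [cite: Masser1975, Ch. III Thm. III] -/
theorem masser_gaussFour :
    Literature.NumberTheory.Transcendental.QbarLinearIndependent
      ![(1 : ℂ), 2 * π * Complex.I, ((varpi : ℝ) : ℂ) * Complex.I,
        ((varpi : ℝ) : ℂ)⁻¹ * (-(π * Complex.I))] := by
  have h2 : IsAlgebraic ℚ gaussFour.g₂ := by
    rw [g₂_gaussFour]
    have : IsAlgebraic ℚ ((4 : ℚ) : ℂ) := isAlgebraic_algebraMap _
    simpa using this
  have h3 : IsAlgebraic ℚ gaussFour.g₃ := by rw [g₃_gaussFour]; exact isAlgebraic_zero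
  have h := Literature.NumberTheory.Transcendental.masser_ellipticPeriods_cm_holds gaussFour h2 h3
    hasCM_gaussFour
  rwa [ω₁_gaussFour, η₁_gaussFour] at h

/-- A real algebraic number is algebraic as a complex number. [folklore] -/
theorem isAlgebraic_ofReal {a : ℝ} (ha : IsAlgebraic ℚ a) : IsAlgebraic ℚ (a : ℂ) := by
  have h := ha.algebraMap (A := ℂ)
  rwa [Complex.coe_algebraMap] at h

/-- **`1, lemHalf, M₄` are linearly independent over the real algebraic numbers**
(`lemHalf = ϖ₀/2 = J₀(44,−56)`, `M₄ = π/(2ϖ₀)`): the transcendence input for the complete list of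
period relations at `j = 66³`. [cite: Masser1975, Ch. III Thm. III] -/
theorem qbarIndep_one_lemHalf_M₄ (a b c : ℝ) (ha : IsAlgebraic ℚ a) (hb : IsAlgebraic ℚ b)
    (hc : IsAlgebraic ℚ c) (h : a + b * lemHalf + c * M₄ = 0) : a = 0 ∧ b = 0 ∧ c = 0 := by
  have hl : lemHalf = varpi / 2 := by rw [varpi_eq]; ring
  have hM : M₄ = π / (2 * varpi) := by rw [M₄_eq_pi_div, varpi_eq]; ring
  have hv : varpi ≠ 0 := varpi_pos.ne'
  -- coefficient vector on Masser's basis `(1, 2πi, ϖ₀ i, −πi/ϖ₀)`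
  let β : Fin 4 → ℂ := ![(a : ℂ), 0, -(Complex.I * b) / 2, Complex.I * c / 2]
  have hβ : ∀ i, IsAlgebraic ℚ (β i) := by
    have h2 : IsAlgebraic ℚ ((2 : ℚ) : ℂ) := isAlgebraic_algebraMap _
    have h2' : IsAlgebraic ℚ (2 : ℂ) := by simpa using h2
    have hinv : IsAlgebraic ℚ ((2 : ℂ)⁻¹) := h2'.inv
    intro i
    fin_cases i
    · exact isAlgebraic_ofReal ha
    · exact isAlgebraic_zero
    · show IsAlgebraic ℚ (-(Complex.I * (b : ℂ)) / 2)
      rw [div_eq_mul_inv]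
      exact ((Literature.NumberTheory.Transcendental.KoblitzOgus.isAlgebraic_I.mul
        (isAlgebraic_ofReal hb)).neg).mul hinv
    · show IsAlgebraic ℚ (Complex.I * (c : ℂ) / 2)
      rw [div_eq_mul_inv]
      exact (Literature.NumberTheory.Transcendental.KoblitzOgus.isAlgebraic_I.mul
        (isAlgebraic_ofReal hc)).mul hinv
  have hsum : ∑ i, β i * ![(1 : ℂ), 2 * π * Complex.I, ((varpi : ℝ) : ℂ) * Complex.I,
      ((varpi : ℝ) : ℂ)⁻¹ * (-(π * Complex.I))] i = 0 := by
    simp only [Fin.sum_univ_four, β, Matrix.cons_val_zero, Matrix.cons_val_one, Matrix.head_cons,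
      Matrix.cons_val_two, Matrix.tail_cons, Matrix.cons_val_three]
    have key : (a : ℂ) + (b : ℂ) * (varpi / 2 : ℝ) + (c : ℂ) * (π / (2 * varpi) : ℝ) = 0 := by
      rw [← hl, ← hM]; exact_mod_cast h
    push_cast at key
    linear_combination key + (-((b : ℂ) * varpi / 2 + (c : ℂ) * π / (2 * varpi))) * Complex.I_sq
  have hz := masser_gaussFour β hβ hsum
  have ha0 : (a : ℂ) = 0 := hz 0
  have hb0 : -(Complex.I * b) / 2 = (0 : ℂ) := hz 2
  have hc0 : Complex.I * c / 2 = (0 : ℂ) := hz 3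
  refine ⟨by exact_mod_cast ha0, ?_, ?_⟩
  · have : (b : ℂ) = 0 := by simpa [Complex.I_ne_zero] using hb0
    exact_mod_cast this
  · have : (c : ℂ) = 0 := by simpa [Complex.I_ne_zero] using hc0
    exact_mod_cast this

end Summit.KontsevichZagierPeriods.RealEllipticSectorKernel.CM66

end
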